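import Literature.Geometry.Lorentzian.KIDGlobalImmersion
import Literature.Geometry.Lorentzian.SpacetimePositiveMassRigidityProofs
import Literature.Geometry.Lorentzian.SpacelikeCompleteCovering
import Literature.Geometry.Lorentzian.SpacelikeCompleteGraph
import Literature.Geometry.Lorentzian.SpacelikeGraphSlope
import Literature.Geometry.Lorentzian.TranslationalKIDBoundedLapse
import Literature.Geometry.Lorentzian.PauliSpinorModel
import HarnessLib

/-!
# The rigid positive energy theorem: what remains after the developing map

With the developing map `InitialDataSet.exists_minkowski_immersion_of_kids`
(`KIDGlobalImmersion.lean`: translational KIDs on a simply connected `3`-manifold integrate to a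
global spacelike immersion into Minkowski space-time with `f^*η = h`, `K_ν = k`) the reduction
`positive_mass_rigidity_spacetime_of_kids` (`SpacetimePositiveMassRigidityProofs.lean`) of the
rigid positive energy theorem (Beig–Chruściel, J. Math. Phys. 37 (1996), Thm. 4.1, `m = 0`)
sharpens to three inputs, each a named step of the printed proof (§4 and App. A):

* `exists_cauchyDevelopment_eq_spacetime_of_isSmoothEmbedding` — **proved**: a smooth embedding
  of the data manifold onto a Cauchy hypersurface of Minkowski space-time, with future unit
  normal, `f^*η = h` and `K_ν = k`, is a `CauchyDevelopment` of the data whose space-time is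
  `Minkowski.spacetime` (the literal conclusion of the fact);
* `positive_mass_rigidity_spacetime_of_kids_of_embedding` — **the reduction**: granted, as
  hypotheses stated in the tree's vocabulary, (A) the analytic half (global translational KIDs
  with Gram matrix `η`, `N₀ > 0`, from Witten's equation with `m = 0`; App. A), (SC) the simple
  connectivity of `Σ` (§4, the one-end/covering argument with [C3]), and (CE) "the developing map
  of one-ended asymptotically flat data is an embedding onto a Cauchy hypersurface" (§4, the
  global `t`-slicing with complete leaves), the named fact `positive_mass_rigidity_spacetime`
  follows.

* `positive_mass_rigidity_spacetime_of_kids_of_cauchy` — **the sharper reduction**: with the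
  covering argument (`SpacelikeCompleteCovering.lean`: the developing map of complete data is a
  smooth embedding onto an entire graph) and the completeness of the data
  (`AsymptoticallyFlatCompletenessWeak.lean`), (CE) shrinks to (C): "an entire spacelike graph
  carrying one-ended asymptotically flat data is a Cauchy hypersurface of Minkowski space-time".

* `positive_mass_rigidity_spacetime_of_kids_of_slope` — **the sharpest reduction**: with
  `SpacelikeCompleteGraph.lean` (the developed slice is, up to the diffeomorphism `π ∘ f`, the
  graph of a smooth `u` with `‖∇u‖ < 1`), (C) shrinks further to (S): "the height function has
  slope uniformly `< 1`", a statement about the asymptotics of the developing map alone.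

* `positive_mass_rigidity_spacetime_of_kids_of_simplyConnected` — **two inputs**: with
  `SpacelikeGraphSlope.lean` (`‖∇u‖² = 1 − N₀⁻²`) the slope bound is the boundedness of the
  lapse `N₀`, which holds on an asymptotically flat one-ended data manifold
  (`TranslationalKIDBoundedLapse.lean`), so the fact follows from the ANALYTIC HALF (global
  translational KIDs) and the SIMPLE CONNECTIVITY of `Σ` alone.

* `positive_mass_rigidity_spacetime_of_witten` — **three analytic–topological inputs**: the
  analytic half is split, via the formalised spinor algebra (`SenParallelSpinorKID.lean`,
  `SenParallelKIDTetrad.lean`, `PauliSpinorModel.lean`), into (Fr) a smooth global orthonormal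
  frame and (W) Witten's existence theorem for Sen–Witten-parallel spinor fields tending to the
  standard basis; plus (SC).

Theorems only; no definitions, no named facts (the inputs are binders, not facts).

## References

* R. Beig, P. T. Chruściel, *Killing vectors in asymptotically flat space-times. I.*, J. Math.
  Phys. 37 (1996) 1939–1961, Thm. 4.1 and its proof, §4; App. A. [BeigChrusciel1996]
* Y. Choquet-Bruhat, R. Geroch, Comm. Math. Phys. 14 (1969) 329–335, p. 330 (developments).
-/

noncomputable section

open Bundle Set Function Manifold Filter
open scoped Manifold ContDiff Topology NNReal

namespace Literature.Geometry.Lorentzian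

/-- **An embedding of the data onto a Cauchy hypersurface of Minkowski space-time is a Cauchy
development which IS Minkowski space-time.** If `f : X → ℝ⁴` is a smooth embedding with future
unit normal `ν`, induced metric `f^*η = h`, second fundamental form `K_ν = k`, and `f(X)` is a
Cauchy hypersurface of `(ℝ⁴, η, ∂ₜ)`, then `(ℝ⁴, η, ∂ₜ, f, ν)` is a Cauchy development of
`(X, h, k)` (`CauchyDevelopment`, Choquet-Bruhat–Geroch 1969, p. 330) whose space-time is
`Minkowski.spacetime` — the literal conclusion of `positive_mass_rigidity_spacetime`.
[cite: BeigChrusciel1996, Thm. 4.1 (last sentence)] -/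
theorem exists_cauchyDevelopment_eq_spacetime_of_isSmoothEmbedding {X : Type}
    [TopologicalSpace X] [ChartedSpace E3 X] [IsManifold (𝓡 3) ∞ X] [ConnectedSpace X]
    {D : InitialDataSet (𝓡 3) X} {f : X → E4} {ν : X → E4}
    (hf : Manifold.IsSmoothEmbedding (𝓡 3) 𝓘(ℝ, E4) ∞ f)
    (hun : Minkowski.smoothMetric.IsFutureUnitNormal (𝓡 3) (Minkowski.timeOrientation.ofLE le_top)
      f ν)
    (hind : ∀ (y : X) (v w : E3),
      Minkowski.smoothMetric.toPseudoRiemannianMetric.inducedBilin (𝓡 3) f y v w = D.h.inner y v w)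
    (hK : ∀ [Minkowski.smoothMetric.toPseudoRiemannianMetric.HasLeviCivita] (y : X) (v w : E3),
      Minkowski.smoothMetric.toPseudoRiemannianMetric.secondFundamentalForm (𝓡 3) f ν y v w =
        D.k y v w)
    (hC : Minkowski.spacetime.metric.IsCauchyHypersurface Minkowski.spacetime.timeOrientation
      (range (α := Minkowski.spacetime.carrier) f)) :
    ∃ 𝒟 : CauchyDevelopment D, 𝒟.toSpacetime = Minkowski.spacetime :=
  ⟨ { toSpacetime := Minkowski.spacetime
      embed := f
      isSmoothEmbedding := hf
      normal := ν
      isFutureUnitNormal := hun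
      induced_h := fun y ↦ ContinuousLinearMap.ext fun v ↦ ContinuousLinearMap.ext fun w ↦
        hind y v w
      induced_k := by
        intro inst y
        exact LinearMap.ext fun v ↦ LinearMap.ext fun w ↦ by
          rw [InitialDataSet.kBilin_apply]
          exact @hK inst y v w
      isCauchyHypersurface := hC }, rfl⟩

/-- **The rigid positive energy theorem reduces to its analytic half, the simple connectivity of
`Σ`, and the embedding/Cauchy property of the developing map.** Refining
`positive_mass_rigidity_spacetime_of_kids` (`SpacetimePositiveMassRigidityProofs.lean`) by the
developing map `InitialDataSet.exists_minkowski_immersion_of_kids` (`KIDGlobalImmersion.lean`):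
granted

* `hA` — the **analytic half** (Witten's equation, App. A): the hypotheses of the theorem give
  global smooth translational KIDs `(N_a, Y_a)` with Gram matrix `η` and `N₀ > 0`;
* `hSC` — **`Σ` is simply connected** (§4: "`Σ̃` has only one asymptotically flat end … it
  follows that `Σ = Σ̃`", via [C3, Lemma 1 and Thm. 1]);
* `hCE` — **the developing map is an embedding onto a Cauchy hypersurface** (§4: the global
  slicing by `t`, complete leaves, "`i(Σ)` is an asymptotically flat Cauchy surface"): on one-ended
  asymptotically flat data, a spacelike immersion into Minkowski space-time inducing `(h, k)` is a
  smooth embedding with Cauchy image;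

the named fact follows: `hA` gives the KIDs, `hSC` and `exists_minkowski_immersion_of_kids` the
global immersion `f` with `f^*η = h`, `K_ν = k`, `hCE` upgrades it, and
`exists_cauchyDevelopment_eq_spacetime_of_isSmoothEmbedding` packages the Cauchy development.
[cite: BeigChrusciel1996, proof of Thm. 4.1, §4 and App. A] -/
theorem positive_mass_rigidity_spacetime_of_kids_of_embedding
    (hA : ∀ (X : Type) [TopologicalSpace X] [ChartedSpace E3 X] [IsManifold (𝓡 3) ∞ X]
      [T2Space X] [SecondCountableTopology X] [ConnectedSpace X]
      (D : InitialDataSet (𝓡 3) X) [D.metric.HasLeviCivita] (e : AFEnd X),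
      D.SatisfiesDominantEnergyCondition → e.IsAsymptoticallyFlat D 1 →
      (∃ q₀, HasSourceDecay e D q₀) → e.IsSoleEnd → e.HasADMEnergy D 0 →
      ∃ (N : Fin 4 → X → ℝ) (Y : Fin 4 → Π x : X, TangentSpace (𝓡 3) x),
        (∀ a, ContMDiff (𝓡 3) 𝓘(ℝ, ℝ) ∞ (N a)) ∧
        (∀ a, ContMDiff (𝓡 3) ((𝓡 3).prod (𝓡 3)) ∞
          fun x ↦ (TotalSpace.mk' E3 x (Y a x) : TangentBundle (𝓡 3) X)) ∧
        (∀ a (x : X) (v w : TangentSpace (𝓡 3) x),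
          D.metric.val x (D.metric.leviCivita (Y a) x v) w = -(N a x * D.k x v w)) ∧
        (∀ a (x : X) (v : TangentSpace (𝓡 3) x),
          mvfderiv (𝓡 3) (N a) x v = -(D.k x v (Y a x))) ∧
        (∀ (x : X) a b, -(N a x * N b x) + D.h.inner x (Y a x) (Y b x) =
          if a = b then (if a = 0 then -1 else 1) else 0) ∧
        ∀ x, 0 < N 0 x)
    (hSC : ∀ (X : Type) [TopologicalSpace X] [ChartedSpace E3 X] [IsManifold (𝓡 3) ∞ X]
      [T2Space X] [SecondCountableTopology X] [ConnectedSpace X]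
      (D : InitialDataSet (𝓡 3) X) [D.metric.HasLeviCivita] (e : AFEnd X),
      D.SatisfiesDominantEnergyCondition → e.IsAsymptoticallyFlat D 1 →
      (∃ q₀, HasSourceDecay e D q₀) → e.IsSoleEnd → e.HasADMEnergy D 0 → SimplyConnectedSpace X)
    (hCE : ∀ (X : Type) [TopologicalSpace X] [ChartedSpace E3 X] [IsManifold (𝓡 3) ∞ X]
      [T2Space X] [SecondCountableTopology X] [ConnectedSpace X]
      (D : InitialDataSet (𝓡 3) X) [D.metric.HasLeviCivita] (e : AFEnd X),
      e.IsAsymptoticallyFlat D 1 → e.IsSoleEnd → ∀ (f : X → E4) (ν : X → E4),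
      Minkowski.smoothMetric.toPseudoRiemannianMetric.IsSpacelikeImmersion (𝓡 3) f →
      Minkowski.smoothMetric.IsFutureUnitNormal (𝓡 3) (Minkowski.timeOrientation.ofLE le_top)
        f ν →
      ContMDiff (𝓡 3) 𝓘(ℝ, E4).tangent ∞
        (fun x ↦ (TotalSpace.mk' E4 (f x) (ν x) : TangentBundle 𝓘(ℝ, E4) E4)) →
      (∀ (x : X) (v w : E3),
        Minkowski.smoothMetric.toPseudoRiemannianMetric.inducedBilin (𝓡 3) f x v w =
          D.h.inner x v w) →
      (∀ [Minkowski.smoothMetric.toPseudoRiemannianMetric.HasLeviCivita] (x : X) (v w : E3),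
        Minkowski.smoothMetric.toPseudoRiemannianMetric.secondFundamentalForm (𝓡 3) f ν x v w =
          D.k x v w) →
      Manifold.IsSmoothEmbedding (𝓡 3) 𝓘(ℝ, E4) ∞ f ∧
        Minkowski.spacetime.metric.IsCauchyHypersurface Minkowski.spacetime.timeOrientation
          (range (α := Minkowski.spacetime.carrier) f)) :
    positive_mass_rigidity_spacetime := by
  intro X _ _ _ _ _ _ D _ e hdec haf hsrc hsole hE
  obtain ⟨N, Y, hN, hY, hDY, hdN, hG, hN0⟩ := hA X D e hdec haf hsrc hsole hE
  haveI : SimplyConnectedSpace X := hSC X D e hdec haf hsrc hsole hE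
  obtain ⟨f, ν, hfi, hun, hlift, -, -, hind, hK⟩ :=
    D.exists_minkowski_immersion_of_kids N Y hN hY hDY hdN hG hN0
  obtain ⟨hemb, hC⟩ := hCE X D e haf hsole f ν hfi hun hlift hind hK
  exact exists_cauchyDevelopment_eq_spacetime_of_isSmoothEmbedding hemb hun hind hK hC

/-- **What remains of the rigid positive energy theorem after the developing map and the
covering argument.** Refining `positive_mass_rigidity_spacetime_of_kids_of_embedding`: the data of
the theorem are complete (`AFEnd.isComplete_of_isAsymptoticallyFlat_of_isSoleEnd`: order-`1`
flatness on a sole end), so the developing map of the KIDs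
(`InitialDataSet.exists_minkowski_immersion_of_kids`) is a smooth embedding onto an entire
spacelike graph over `{t = 0}` (`InitialDataSet.isSmoothEmbedding_of_isComplete`: the spatial
projection is a covering of `ℝ³`, Lee 2018, Thm. 6.23, hence a homeomorphism). Granted

* `hA` — the **analytic half** (global translational KIDs with Gram matrix `η`, `N₀ > 0`;
  Witten's equation, App. A),
* `hSC` — **`Σ` is simply connected** (§4: the universal cover `Σ̃ ≈ ℝ³` has one end per sheet,
  `Σ` has one end, so `Σ = Σ̃`),
* `hC` — **an entire spacelike graph carrying one-ended asymptotically flat data is a Cauchy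
  hypersurface** of Minkowski space-time (§4: "`i(Σ)` is an asymptotically flat Cauchy
  surface"; the slope of the height function is bounded away from `1` by asymptotic flatness),

the named fact `positive_mass_rigidity_spacetime` follows.
[cite: BeigChrusciel1996, proof of Thm. 4.1, §4 and App. A] -/
theorem positive_mass_rigidity_spacetime_of_kids_of_cauchy
    (hA : ∀ (X : Type) [TopologicalSpace X] [ChartedSpace E3 X] [IsManifold (𝓡 3) ∞ X]
      [T2Space X] [SecondCountableTopology X] [ConnectedSpace X]
      (D : InitialDataSet (𝓡 3) X) [D.metric.HasLeviCivita] (e : AFEnd X),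
      D.SatisfiesDominantEnergyCondition → e.IsAsymptoticallyFlat D 1 →
      (∃ q₀, HasSourceDecay e D q₀) → e.IsSoleEnd → e.HasADMEnergy D 0 →
      ∃ (N : Fin 4 → X → ℝ) (Y : Fin 4 → Π x : X, TangentSpace (𝓡 3) x),
        (∀ a, ContMDiff (𝓡 3) 𝓘(ℝ, ℝ) ∞ (N a)) ∧
        (∀ a, ContMDiff (𝓡 3) ((𝓡 3).prod (𝓡 3)) ∞
          fun x ↦ (TotalSpace.mk' E3 x (Y a x) : TangentBundle (𝓡 3) X)) ∧
        (∀ a (x : X) (v w : TangentSpace (𝓡 3) x),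
          D.metric.val x (D.metric.leviCivita (Y a) x v) w = -(N a x * D.k x v w)) ∧
        (∀ a (x : X) (v : TangentSpace (𝓡 3) x),
          mvfderiv (𝓡 3) (N a) x v = -(D.k x v (Y a x))) ∧
        (∀ (x : X) a b, -(N a x * N b x) + D.h.inner x (Y a x) (Y b x) =
          if a = b then (if a = 0 then -1 else 1) else 0) ∧
        ∀ x, 0 < N 0 x)
    (hSC : ∀ (X : Type) [TopologicalSpace X] [ChartedSpace E3 X] [IsManifold (𝓡 3) ∞ X]
      [T2Space X] [SecondCountableTopology X] [ConnectedSpace X]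
      (D : InitialDataSet (𝓡 3) X) [D.metric.HasLeviCivita] (e : AFEnd X),
      D.SatisfiesDominantEnergyCondition → e.IsAsymptoticallyFlat D 1 →
      (∃ q₀, HasSourceDecay e D q₀) → e.IsSoleEnd → e.HasADMEnergy D 0 → SimplyConnectedSpace X)
    (hC : ∀ (X : Type) [TopologicalSpace X] [ChartedSpace E3 X] [IsManifold (𝓡 3) ∞ X]
      [T2Space X] [SecondCountableTopology X] [ConnectedSpace X]
      (D : InitialDataSet (𝓡 3) X) [D.metric.HasLeviCivita] (e : AFEnd X),
      e.IsAsymptoticallyFlat D 1 → e.IsSoleEnd → ∀ (f : X → E4) (ν : X → E4),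
      Manifold.IsSmoothEmbedding (𝓡 3) 𝓘(ℝ, E4) ∞ f →
      Minkowski.smoothMetric.IsFutureUnitNormal (𝓡 3) (Minkowski.timeOrientation.ofLE le_top)
        f ν →
      ContMDiff (𝓡 3) 𝓘(ℝ, E4).tangent ∞
        (fun x ↦ (TotalSpace.mk' E4 (f x) (ν x) : TangentBundle 𝓘(ℝ, E4) E4)) →
      (∀ (x : X) (v w : E3),
        Minkowski.smoothMetric.toPseudoRiemannianMetric.inducedBilin (𝓡 3) f x v w =
          D.h.inner x v w) →
      (∀ [Minkowski.smoothMetric.toPseudoRiemannianMetric.HasLeviCivita] (x : X) (v w : E3),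
        Minkowski.smoothMetric.toPseudoRiemannianMetric.secondFundamentalForm (𝓡 3) f ν x v w =
          D.k x v w) →
      (∃ u : E3 → ℝ, Continuous u ∧ range f = range fun y : E3 ↦ E4.ofTimeSpace (u y) y) →
      Minkowski.spacetime.metric.IsCauchyHypersurface Minkowski.spacetime.timeOrientation
        (range (α := Minkowski.spacetime.carrier) f)) :
    positive_mass_rigidity_spacetime := by
  intro X _ _ _ _ _ _ D _ e hdec haf hsrc hsole hE
  obtain ⟨N, Y, hN, hY, hDY, hdN, hG, hN0⟩ := hA X D e hdec haf hsrc hsole hE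
  haveI : SimplyConnectedSpace X := hSC X D e hdec haf hsrc hsole hE
  obtain ⟨f, ν, hfi, hun, hlift, -, -, hind, hK⟩ :=
    D.exists_minkowski_immersion_of_kids N Y hN hY hDY hdN hG hN0
  have hc : D.IsComplete := AFEnd.isComplete_of_isAsymptoticallyFlat_of_isSoleEnd one_pos haf hsole
  obtain ⟨hemb, hgraph⟩ := D.isSmoothEmbedding_of_isComplete hc hfi hind
  have hCf := hC X D e haf hsole f ν hemb hun hlift hind hK hgraph
  exact exists_cauchyDevelopment_eq_spacetime_of_isSmoothEmbedding hemb hun hind hK hCf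

/-- **The sharpest reduction: analytic half, simple connectivity, and a uniform slope bound.**
By `InitialDataSet.exists_diffeomorph_graph_of_isComplete` (`SpacelikeCompleteGraph.lean`) the
developed slice of the (complete) data is, after the diffeomorphism `Φ = π ∘ f : X ≅ ℝ³`, the
entire graph of a smooth height function `u` with `‖∇u‖ < 1`, and it is a Cauchy hypersurface as
soon as `‖du‖ ≤ θ < 1` uniformly (`isCauchyHypersurface_range_of_slope_le`). So the rigid
positive energy theorem follows from

* `hA` — the **analytic half** (global translational KIDs with Gram matrix `η`, `N₀ > 0`);
* `hSC` — **`Σ` is simply connected**;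
* `hS` — **the height function of the developed slice of one-ended asymptotically flat data
  has slope uniformly `< 1`** (Beig–Chruściel 1996, §4: the KIDs are asymptotic to the
  translations of a fixed Minkowski frame on the end, [6, Prop. 2.1], so the embedding is
  asymptotically an affine spacelike hyperplane).

[cite: BeigChrusciel1996, proof of Thm. 4.1, §4 and App. A] -/
theorem positive_mass_rigidity_spacetime_of_kids_of_slope
    (hA : ∀ (X : Type) [TopologicalSpace X] [ChartedSpace E3 X] [IsManifold (𝓡 3) ∞ X]
      [T2Space X] [SecondCountableTopology X] [ConnectedSpace X]
      (D : InitialDataSet (𝓡 3) X) [D.metric.HasLeviCivita] (e : AFEnd X),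
      D.SatisfiesDominantEnergyCondition → e.IsAsymptoticallyFlat D 1 →
      (∃ q₀, HasSourceDecay e D q₀) → e.IsSoleEnd → e.HasADMEnergy D 0 →
      ∃ (N : Fin 4 → X → ℝ) (Y : Fin 4 → Π x : X, TangentSpace (𝓡 3) x),
        (∀ a, ContMDiff (𝓡 3) 𝓘(ℝ, ℝ) ∞ (N a)) ∧
        (∀ a, ContMDiff (𝓡 3) ((𝓡 3).prod (𝓡 3)) ∞
          fun x ↦ (TotalSpace.mk' E3 x (Y a x) : TangentBundle (𝓡 3) X)) ∧
        (∀ a (x : X) (v w : TangentSpace (𝓡 3) x),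
          D.metric.val x (D.metric.leviCivita (Y a) x v) w = -(N a x * D.k x v w)) ∧
        (∀ a (x : X) (v : TangentSpace (𝓡 3) x),
          mvfderiv (𝓡 3) (N a) x v = -(D.k x v (Y a x))) ∧
        (∀ (x : X) a b, -(N a x * N b x) + D.h.inner x (Y a x) (Y b x) =
          if a = b then (if a = 0 then -1 else 1) else 0) ∧
        ∀ x, 0 < N 0 x)
    (hSC : ∀ (X : Type) [TopologicalSpace X] [ChartedSpace E3 X] [IsManifold (𝓡 3) ∞ X]
      [T2Space X] [SecondCountableTopology X] [ConnectedSpace X]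
      (D : InitialDataSet (𝓡 3) X) [D.metric.HasLeviCivita] (e : AFEnd X),
      D.SatisfiesDominantEnergyCondition → e.IsAsymptoticallyFlat D 1 →
      (∃ q₀, HasSourceDecay e D q₀) → e.IsSoleEnd → e.HasADMEnergy D 0 → SimplyConnectedSpace X)
    (hS : ∀ (X : Type) [TopologicalSpace X] [ChartedSpace E3 X] [IsManifold (𝓡 3) ∞ X]
      [T2Space X] [SecondCountableTopology X] [ConnectedSpace X]
      (D : InitialDataSet (𝓡 3) X) [D.metric.HasLeviCivita] (e : AFEnd X),
      e.IsAsymptoticallyFlat D 1 → e.IsSoleEnd →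
      ∀ (f : X → E4) (ν : X → E4) (Φ : X ≃ₘ^∞⟮𝓡 3, 𝓘(ℝ, E3)⟯ E3) (u : E3 → ℝ),
      Minkowski.smoothMetric.toPseudoRiemannianMetric.IsSpacelikeImmersion (𝓡 3) f →
      Minkowski.smoothMetric.IsFutureUnitNormal (𝓡 3) (Minkowski.timeOrientation.ofLE le_top)
        f ν →
      (∀ (x : X) (v w : E3),
        Minkowski.smoothMetric.toPseudoRiemannianMetric.inducedBilin (𝓡 3) f x v w =
          D.h.inner x v w) →
      (∀ [Minkowski.smoothMetric.toPseudoRiemannianMetric.HasLeviCivita] (x : X) (v w : E3),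
        Minkowski.smoothMetric.toPseudoRiemannianMetric.secondFundamentalForm (𝓡 3) f ν x v w =
          D.k x v w) →
      ContDiff ℝ ∞ u → (∀ x, Φ x = E4.spatial (f x)) →
      (∀ y, f (Φ.symm y) = E4.ofTimeSpace (u y) y) →
      ∃ θ : ℝ≥0, θ < 1 ∧ ∀ y, ‖fderiv ℝ u y‖₊ ≤ θ) :
    positive_mass_rigidity_spacetime := by
  intro X _ _ _ _ _ _ D _ e hdec haf hsrc hsole hE
  obtain ⟨N, Y, hN, hY, hDY, hdN, hG, hN0⟩ := hA X D e hdec haf hsrc hsole hE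
  haveI : SimplyConnectedSpace X := hSC X D e hdec haf hsrc hsole hE
  obtain ⟨f, ν, hfi, hun, -, -, -, hind, hK⟩ :=
    D.exists_minkowski_immersion_of_kids N Y hN hY hDY hdN hG hN0
  have hc : D.IsComplete := AFEnd.isComplete_of_isAsymptoticallyFlat_of_isSoleEnd one_pos haf hsole
  obtain ⟨hemb, -⟩ := D.isSmoothEmbedding_of_isComplete hc hfi hind
  obtain ⟨Φ, u, hus, hΦ, hgraph, -⟩ := D.exists_diffeomorph_graph_of_isComplete hc hfi hind
  obtain ⟨θ, hθ, hb⟩ := hS X D e haf hsole f ν Φ u hfi hun hind hK hus hΦ hgraph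
  exact exists_cauchyDevelopment_eq_spacetime_of_isSmoothEmbedding hemb hun hind hK
    (InitialDataSet.isCauchyHypersurface_range_of_slope_le Φ (hus.differentiable (by simp))
      hgraph hθ hb)

/-- **Two inputs suffice: the analytic half and simple connectivity.** By
`InitialDataSet.norm_gradient_height_sq_eq` (`SpacelikeGraphSlope.lean`) the slope of the
developed slice is `‖∇u‖² = 1 − N₀⁻²`, `N₀ = ν⁰` the lapse of the timelike translational KID
(`ν = (−ε_a N_a)_a`), so the uniform slope bound of
`positive_mass_rigidity_spacetime_of_kids_of_slope` is the boundedness of `N₀` on `Σ`; and `N₀`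
IS bounded on an asymptotically flat one-ended data manifold, by the lapse equation
`dN₀ = −k(·, Y₀)`, the Gram identity `h(Y₀, Y₀) = N₀² − 1` and the decay `k = O(r⁻²)`
(`AFEnd.exists_forall_lapse_le`, `TranslationalKIDBoundedLapse.lean`; Beig–Chruściel 1996,
§2, Prop. 2.2). Hence the rigid positive energy theorem follows from exactly

* `hA` — the **analytic half**: under the hypotheses of the theorem there are global smooth
  translational KIDs `(N_a, Y_a)_{a<4}` (shift equation, lapse equation, Gram matrix `η`,
  `N₀ > 0`) — Witten's equation with `m = 0` and App. A, (A.7)–(A.11.0);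
* `hSC` — **`Σ` is simply connected** (§4: the universal cover has one end per sheet).

[cite: BeigChrusciel1996, proof of Thm. 4.1, §4 and App. A; §2, Prop. 2.2] -/
theorem positive_mass_rigidity_spacetime_of_kids_of_simplyConnected
    (hA : ∀ (X : Type) [TopologicalSpace X] [ChartedSpace E3 X] [IsManifold (𝓡 3) ∞ X]
      [T2Space X] [SecondCountableTopology X] [ConnectedSpace X]
      (D : InitialDataSet (𝓡 3) X) [D.metric.HasLeviCivita] (e : AFEnd X),
      D.SatisfiesDominantEnergyCondition → e.IsAsymptoticallyFlat D 1 →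
      (∃ q₀, HasSourceDecay e D q₀) → e.IsSoleEnd → e.HasADMEnergy D 0 →
      ∃ (N : Fin 4 → X → ℝ) (Y : Fin 4 → Π x : X, TangentSpace (𝓡 3) x),
        (∀ a, ContMDiff (𝓡 3) 𝓘(ℝ, ℝ) ∞ (N a)) ∧
        (∀ a, ContMDiff (𝓡 3) ((𝓡 3).prod (𝓡 3)) ∞
          fun x ↦ (TotalSpace.mk' E3 x (Y a x) : TangentBundle (𝓡 3) X)) ∧
        (∀ a (x : X) (v w : TangentSpace (𝓡 3) x),
          D.metric.val x (D.metric.leviCivita (Y a) x v) w = -(N a x * D.k x v w)) ∧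
        (∀ a (x : X) (v : TangentSpace (𝓡 3) x),
          mvfderiv (𝓡 3) (N a) x v = -(D.k x v (Y a x))) ∧
        (∀ (x : X) a b, -(N a x * N b x) + D.h.inner x (Y a x) (Y b x) =
          if a = b then (if a = 0 then -1 else 1) else 0) ∧
        ∀ x, 0 < N 0 x)
    (hSC : ∀ (X : Type) [TopologicalSpace X] [ChartedSpace E3 X] [IsManifold (𝓡 3) ∞ X]
      [T2Space X] [SecondCountableTopology X] [ConnectedSpace X]
      (D : InitialDataSet (𝓡 3) X) [D.metric.HasLeviCivita] (e : AFEnd X),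
      D.SatisfiesDominantEnergyCondition → e.IsAsymptoticallyFlat D 1 →
      (∃ q₀, HasSourceDecay e D q₀) → e.IsSoleEnd → e.HasADMEnergy D 0 → SimplyConnectedSpace X) :
    positive_mass_rigidity_spacetime := by
  intro X _ _ _ _ _ _ D _ e hdec haf hsrc hsole hE
  obtain ⟨N, Y, hN, hY, hDY, hdN, hG, hN0⟩ := hA X D e hdec haf hsrc hsole hE
  haveI : SimplyConnectedSpace X := hSC X D e hdec haf hsrc hsole hE
  -- the lapse `N₀` is bounded (`h(Y₀, Y₀) = N₀² − 1 ≤ N₀²` by the Gram identity)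
  have hYN : ∀ x, D.h.inner x (Y 0 x) (Y 0 x) ≤ N 0 x ^ 2 := fun x ↦ by
    have h := hG x 0 0
    simp only [↓reduceIte] at h
    nlinarith
  obtain ⟨B, hNB⟩ := AFEnd.exists_forall_lapse_le one_pos haf hsole
    (fun x ↦ (hN 0 x).mdifferentiableAt (by simp)) (hdN 0) hYN hN0
  obtain ⟨f, ν, hfi, hun, -, -, hν, hind, hK⟩ :=
    D.exists_minkowski_immersion_of_kids N Y hN hY hDY hdN hG hN0
  have hc : D.IsComplete := AFEnd.isComplete_of_isAsymptoticallyFlat_of_isSoleEnd one_pos haf hsole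
  obtain ⟨hemb, -⟩ := D.isSmoothEmbedding_of_isComplete hc hfi hind
  obtain ⟨Φ, u, hus, -, hgraph, -⟩ := D.exists_diffeomorph_graph_of_isComplete hc hfi hind
  -- the time component of `ν` is the lapse `N₀`
  have htime : ∀ x, E4.time (ν x) = N 0 x := fun x ↦ by
    rw [hν x]
    show (WithLp.toLp 2 fun a ↦ -((if a = 0 then -1 else 1 : ℝ) * N a x)) 0 = N 0 x
    simp
  obtain ⟨θ, hθ, hb⟩ := InitialDataSet.exists_slope_le_of_time_normal_le hfi.contMDiff_self Φ
    (hus.differentiable (by simp)) hgraph hun.1 (B := B) (fun x ↦ (htime x).symm ▸ hNB x)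
    (fun x ↦ (htime x).symm ▸ hN0 x)
  exact exists_cauchyDevelopment_eq_spacetime_of_isSmoothEmbedding hemb hun hind hK
    (InitialDataSet.isCauchyHypersurface_range_of_slope_le Φ (hus.differentiable (by simp))
      hgraph hθ hb)

/-- **The rigid positive energy theorem from Witten's spinors.** With the algebra of App. A
formalised (`SenParallelSpinorKID.lean`, `SenParallelKIDTetrad.lean`, `PauliSpinorModel.lean`:
Sen–Witten-parallel spinor fields give the translational KIDs, with Gram matrix `η` as soon as
the spinors tend to the standard basis at infinity), the analytic half `hA` of
`positive_mass_rigidity_spacetime_of_kids_of_simplyConnected` splits into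

* `hFr` — **a smooth global `h`-orthonormal frame** `(F₁, F₂, F₃)` of the data manifold
  (orientable `3`-manifolds are parallelizable; Parker–Taubes 1982, §2: the spin structure is
  trivial over the ends and the frame fixes the spinor components);
* `hW` — **Witten's existence theorem**: under the hypotheses of the theorem (dominant energy,
  asymptotic flatness, `E_ADM = 0`), for every such frame there are two smooth spinor fields
  `ψ₁, ψ₂ : X → ℝ⁴ ≅ ℂ²`, parallel for the Sen–Witten connection of the frame
  (`dψ(v) = ¼ Σ h(∇ᵥFᵢ, Fⱼ) σᵢσⱼψ − ½ Σ k(v, Fᵢ) σᵢψ`, real Pauli operators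
  `PauliModel.pauli`), tending to the standard basis `(1,0)`, `(0,1)` along some nontrivial
  filter (Witten 1981, §3: solve `𝒟̸ψ = 0` with `ψ → ψ_∞`; `E = 0` forces `𝒟ψ = 0` by the
  Lichnerowicz–Witten identity; Parker–Taubes 1982, Thm. 4.3; Beig–Chruściel 1996, App. A,
  (A.7)–(A.10));

and `hSC` (simple connectivity, §4) as before. [cite: BeigChrusciel1996, Thm. 4.1, §4 and App. A] -/
theorem positive_mass_rigidity_spacetime_of_witten
    (hFr : ∀ (X : Type) [TopologicalSpace X] [ChartedSpace E3 X] [IsManifold (𝓡 3) ∞ X]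
      [T2Space X] [SecondCountableTopology X] [ConnectedSpace X]
      (D : InitialDataSet (𝓡 3) X) [D.metric.HasLeviCivita] (e : AFEnd X),
      D.SatisfiesDominantEnergyCondition → e.IsAsymptoticallyFlat D 1 →
      (∃ q₀, HasSourceDecay e D q₀) → e.IsSoleEnd → e.HasADMEnergy D 0 →
      ∃ F : Fin 3 → Π x : X, TangentSpace (𝓡 3) x,
        (∀ i, ContMDiff (𝓡 3) ((𝓡 3).prod 𝓘(ℝ, E3)) ∞
          fun y ↦ (TotalSpace.mk' E3 y (F i y) : TangentBundle (𝓡 3) X)) ∧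
        ∀ x i j, D.h.inner x (F i x) (F j x) = if i = j then 1 else 0)
    (hW : ∀ (X : Type) [TopologicalSpace X] [ChartedSpace E3 X] [IsManifold (𝓡 3) ∞ X]
      [T2Space X] [SecondCountableTopology X] [ConnectedSpace X]
      (D : InitialDataSet (𝓡 3) X) [D.metric.HasLeviCivita] (e : AFEnd X),
      D.SatisfiesDominantEnergyCondition → e.IsAsymptoticallyFlat D 1 →
      (∃ q₀, HasSourceDecay e D q₀) → e.IsSoleEnd → e.HasADMEnergy D 0 →
      ∀ F : Fin 3 → Π x : X, TangentSpace (𝓡 3) x,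
        (∀ i, ContMDiff (𝓡 3) ((𝓡 3).prod 𝓘(ℝ, E3)) ∞
          fun y ↦ (TotalSpace.mk' E3 y (F i y) : TangentBundle (𝓡 3) X)) →
        (∀ x i j, D.h.inner x (F i x) (F j x) = if i = j then 1 else 0) →
        ∃ (ψ₁ ψ₂ : X → PauliModel.Spinor) (l : Filter X), l.NeBot ∧
          ContMDiff (𝓡 3) 𝓘(ℝ, PauliModel.Spinor) ∞ ψ₁ ∧
          ContMDiff (𝓡 3) 𝓘(ℝ, PauliModel.Spinor) ∞ ψ₂ ∧
          (∀ (x : X) (v : TangentSpace (𝓡 3) x), mvfderiv (𝓡 3) ψ₁ x v =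
            (1 / 4 : ℝ) • (∑ i, ∑ j,
              D.metric.val x (D.metric.leviCivita (F i) x v) (F j x) •
                PauliModel.pauli i (PauliModel.pauli j (ψ₁ x))) -
              (1 / 2 : ℝ) • ∑ i, D.k x v (F i x) • PauliModel.pauli i (ψ₁ x)) ∧
          (∀ (x : X) (v : TangentSpace (𝓡 3) x), mvfderiv (𝓡 3) ψ₂ x v =
            (1 / 4 : ℝ) • (∑ i, ∑ j,
              D.metric.val x (D.metric.leviCivita (F i) x v) (F j x) •
                PauliModel.pauli i (PauliModel.pauli j (ψ₂ x))) -
              (1 / 2 : ℝ) • ∑ i, D.k x v (F i x) • PauliModel.pauli i (ψ₂ x)) ∧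
          Tendsto ψ₁ l (𝓝 (EuclideanSpace.single 0 1)) ∧
          Tendsto ψ₂ l (𝓝 (EuclideanSpace.single 2 1)))
    (hSC : ∀ (X : Type) [TopologicalSpace X] [ChartedSpace E3 X] [IsManifold (𝓡 3) ∞ X]
      [T2Space X] [SecondCountableTopology X] [ConnectedSpace X]
      (D : InitialDataSet (𝓡 3) X) [D.metric.HasLeviCivita] (e : AFEnd X),
      D.SatisfiesDominantEnergyCondition → e.IsAsymptoticallyFlat D 1 →
      (∃ q₀, HasSourceDecay e D q₀) → e.IsSoleEnd → e.HasADMEnergy D 0 → SimplyConnectedSpace X) :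
    positive_mass_rigidity_spacetime := by
  refine positive_mass_rigidity_spacetime_of_kids_of_simplyConnected ?_ hSC
  intro X _ _ _ _ _ _ D _ e hdec haf hsrc hsole hE
  obtain ⟨F, hF, horth⟩ := hFr X D e hdec haf hsrc hsole hE
  obtain ⟨ψ₁, ψ₂, l, hl, h1s, h2s, h1, h2, hl₁, hl₂⟩ := hW X D e hdec haf hsrc hsole hE F hF horth
  haveI := hl
  obtain ⟨N, Y, hNs, hYs, hDY, hdN, hG, hN0⟩ :=
    PauliModel.exists_kids_of_pauli_parallel_spinors_of_tendsto D hF horth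
      (fun i j x v ↦ D.metric.val x (D.metric.leviCivita (F i) x v) (F j x)) (fun _ _ _ _ ↦ rfl)
      h1s h2s h1 h2 hl₁ hl₂
  exact ⟨N, Y, hNs, hYs, hDY, hdN, hG, hN0⟩

end Literature.Geometry.Lorentzian

end
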